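import Literature.MathematicalPhysics.QuantumFieldTheory.Balaban1983to89.B15Prop1SliceIneq167

/-!
# `Balaban1983to89.B15Prop1StdInstanceSU2Box` — [Balaban1989LargeFieldI] Proposition 1 p. 194 FOR PRINT'S FUNCTION (1.77)
# `V_k ↦ A(U_{k,Z}(V_k))` (`B15Sect1Instances.fun177std`, the instance of record `B15Prop1Carrier.InstOn.std` with its example domain
# `|∂V_k − 1| < a₁ on Z`) at `SU(2)` on parallelepipeds: the N12∕s1 chain with (c3″) supplied by the [15] (181) covariance and `hdom` by `rfl`

statement-level skeleton of published theorems with citation tags; proofs where landed; nothing here is a claim about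
the Yang–Mills mass gap

[Balaban1989LargeFieldI] p. 194, verbatim: *"Let us define the function V_k → A((U_{k,Z}(V_k)), (1.77) where V_k is a new integration
variable in (1.76). It is defined on configurations V_k satisfying mild regularity conditions, e.g., |∂V_k − 1| < a₁ on Z, and it is
invariant with respect to gauge transformations of V_k defined on Λ^{(k)}, hence it can be considered as defined on orbits of this group."*
The invariance is r11's `fun177_gaugeAct` over the (181) [15] covariance of the solution map (`B15Prop1Carrier.std_f_gaugeAct`).

Cell pub-ymgap, HUMAN RULING D-0062 (Track A full width), seat `pub-ymgap-dag-n12-c` (R134 acceleration seat (a), strategy s1 of DAG node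
N12 = [B15]; generation g3, fourth product).

WHAT THIS FILE PROVES (one theorem; Mathlib + the import; no `sorry`, no definition, no `… : Prop` fact; axioms standard).
**`prop1Printed_lfVarOn_std_su2_box`** — `B15.Prop1Printed (lfVarOn su2Chart (fun i => InstOn.std bg M₁ (Z i) (Λ i) (k i) (M i) (a₁ i) (An i)))`:
`B15Prop1SliceIneq167.prop1Printed_lfVarOn_su2_box_G0_of_167` AT PRINT'S INSTANCES — the function is (1.77) of record, the domain is print's
example `domReg Z k a₁` (so `hdom` is `rfl`), the regularity hypothesis reads literally `|V_k(∂p′) − 1| < ε for p′ ⊂ (Z∩Λᶜ)^{(k)}`, and the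
Λ-invariance letter (c3″) is SUPPLIED from `hk : k ≤ m + K` and the (181) covariance `h181` (a located [15] letter on NODE 00's solution map,
displayed).  Remaining hypotheses: `hlead` (p. 357 identification) + `hsm`∕`hγle`∕`hbxM`, (m2)–(m5)+(c3) (NODE 00's expansion pieces at the
p. 193 extension), `h181`, (x) `hAn`, thresholds (jointly satisfiable, `B15Prop1CarrierOnSU2BoxExt193.thresholds_exist`).

HONEST SCOPE.  Count-neutral repackaging at print's instance; NOT a discharge of N12; NOT summit progress; nothing continuum ∕ OS ∕ mass-gap ∕ Clay.
-/

noncomputable section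

open Set Finset
open scoped BigOperators Matrix RealInnerProductSpace Real
open Classical

namespace Literature.MathematicalPhysics.QuantumFieldTheory.Balaban1983to89.B15Prop1StdInstanceSU2Box

open B15DeterminingSets GaugeField B16Sect1Backgrounds B15Prop1Carrier B8Eq17ClassAkV1
open B15Prop1CarrierOnSU2Box B15Prop1SliceIneq18 B15Prop1CarrierOnSU2BoxIneq19 B15Prop1CarrierOnSU2BoxExt193 B15Prop1SliceIneq167
open T4CubeChartGnomonic (SU2)
open B15Prop1ChartSU2 (su2Chart)
open B15Prop1SliceCoordinates (GaugeSlice ιA freeBonds)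
open T4AxialGaugeSmallField (castSite boxPlaqs)
open B7Prop1Explicit (e e_apply)
open B6BondElimination (unitVec unitVec_apply)
open B6TreeGaugePoincare (curl)
open B16Eq18Proof (box mem_box)
open B15Extension193 (extend)
open B15ShellGauge193 (shellGauge)
open B5Prop11Plancherel (Tor)
open B5Bounds167Lattice (formDk ofRealCfg)
open B14.Eq213DetSet B14.Eq216Concrete B14.Eq12InteriorLocality B15Sect1Instances B15Eq177GaugeInvariance
open Literature.MathematicalPhysics.QuantumFieldTheory.BalabanImbrieJaffe1984to88.BIJ85Eq453GaugeField

variable {P : Params}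

/-- **PROPOSITION 1 [IV] FOR PRINT'S FUNCTION (1.77) AT `SU(2)` ON PARALLELEPIPEDS** (`x₁`-axial `G₀`, printed chart, slice coordinates,
p. 193 extension, (1.67) [10] consumed, (1.8)∕(1.9) proved): `B15Prop1SliceIneq167.prop1Printed_lfVarOn_su2_box_G0_of_167` at the instances
`InstOn.std bg M₁ (Z i) (Λ i) (k i) (M i) (a₁ i) (An i)` — (c3″) from `std_f_gaugeAct` over (181), `hdom` by `rfl`.
[cite: Balaban1989LargeFieldI, Prop. 1 (1.77)–(1.78) p.194; Balaban1989LargeFieldII, pp.357–359; Balaban1985Variational, (181) p.307] -/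
theorem prop1Printed_lfVarOn_std_su2_box (hd3 : 3 ≤ P.d) (h0 : 0 < P.d) {ι : Type} {av : ∀ j, Averaging P j SU2}
    (bg : DetBackground P SU2 av) (M₁ : ℕ) (Z Λ : ι → Set (Site P 0)) (k : ι → ℕ) (M a₁ : ι → ℝ)
    (An : ∀ i, ℝ → GaugeField P (k i) SU2 → Prop) (hk : ∀ i, k i ≤ P.m + P.K)
    -- (c3″) REPLACED by the [15] (181) covariance of the solution map at print's instance (`B15Prop1Carrier.std_f_gaugeAct`)
    (h181 : ∀ i (u : GaugeTransf P (k i) SU2), Cov181 bg (Bj M₁ (Z i) (k i)) (blockLift (k i) u))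
    (T : ∀ i, Finset (PBond P (k i)))
    {F : ι → Type*} [∀ i, NormedAddCommGroup (F i)] [∀ i, InnerProductSpace ℝ (F i)]
    (H : ∀ i, GaugeField P (k i) SU2 →
      (GaugeSlice (pts (k i) (Λ i)) (T i) (EuclideanSpace ℝ (Fin 3)) →ₗ[ℝ] F i))
    (Hst : ∀ i, GaugeField P (k i) SU2 →
      (F i →ₗ[ℝ] GaugeSlice (pts (k i) (Λ i)) (T i) (EuclideanSpace ℝ (Fin 3))))
    (hadj : ∀ i Vk (x : GaugeSlice (pts (k i) (Λ i)) (T i) (EuclideanSpace ℝ (Fin 3))) (y : F i),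
      ⟪H i Vk x, y⟫ = ⟪x, Hst i Vk y⟫)
    (Δ₁ : ∀ i, GaugeField P (k i) SU2 → (F i →ₗ[ℝ] F i)) (dV : ∀ i, GaugeField P (k i) SU2 → F i → F i)
    (J : ∀ i, GaugeField P (k i) SU2 → F i)
    (lo hi : ι → Fin P.d → ℤ) (n : ι → ℕ) (hn : ∀ i κ, hi i κ ≤ lo i κ + n i) (hN : ∀ i, n i + 2 < P.sitesPerDir (k i))
    (hbox : ∀ i, pts (k i) (Λ i) = (castSite '' Set.Icc (lo i) (hi i) : Set (Site P (k i))))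
    (hZ : ∀ i, (boxPlaqs (lo i - 1) (hi i + 1) : Set (Plaq P (k i))) ⊆ plaqsInside (pts (k i) (Z i)))
    (hTG0 : ∀ i, T i = (box (fun κ => (hi i κ - lo i κ + 1).toNat) (lo i)).image fun x =>
      (⟨castSite (x - unitVec ⟨0, h0⟩), ⟨0, h0⟩⟩ : PBond P (k i)))
    (hN5 : ∀ i κ, ((hi i κ - lo i κ + 1).toNat : ℤ) + 5 < P.sitesPerDir (k i))
    (K : ι → ℕ) (hK1 : ∀ i, 1 ≤ K i) (hKn : ∀ i κ, (hi i κ - lo i κ + 1).toNat ≤ K i)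
    (ext : ∀ i, GaugeField P (k i) SU2 → GaugeField P (k i) SU2)
    -- (ℓ2) REPLACED: the extension is r12's p. 193 shell-gauge extension, `Λ` non-degenerate, constant bookkeeping `hbxM`
    (hext : ∀ i Vk, ext i Vk = extend (pts (k i) (Λ i)) (shellGauge Vk (lo i) (hi i)) Vk)
    (hlohi : ∀ i, lo i ≤ hi i)
    {γ h₁ hst cJ bx : ℝ} (hγ : 0 < γ) (hh₁ : 0 ≤ h₁) (hhst : 0 ≤ hst) (hcJ : 0 ≤ cJ) (hbx : 0 ≤ bx)
    (hbxM : ∀ i, 12 * (P.d : ℝ) * ((n i : ℝ) + 2) ^ 2 ≤ bx * (M i) ^ 2)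
    {ℓ ρ r eA eD δc Cerr : ι → ℝ} (hℓ : ∀ i, 0 ≤ ℓ i) (hr : ∀ i, 0 < r i) (heA : ∀ i, 0 < eA i) (heD : ∀ i, 0 < eD i)
    (hδc : ∀ i, 0 < δc i) (ha₁ : ∀ i, 0 ≤ a₁ i) (hM : ∀ i, 1 ≤ (M i))
    (n' : ι → ℕ) (hn' : ∀ i, 1 ≤ n' i)
    (hlead : ∀ i Vk (X : GaugeSlice (pts (k i) (Λ i)) (T i) (EuclideanSpace ℝ (Fin 3))),
      |⟪H i Vk X, Δ₁ i Vk (H i Vk X)⟫ -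
          ∑ a : Fin 3, formDk (n' i) (fun _ : Fin P.d => P.sitesPerDir (k i))
            (ofRealCfg (fun _ : Fin P.d => P.sitesPerDir (k i)) fun j =>
              ιA (pts (k i) (Λ i)) (T i) X ⟨j.1, j.2⟩ a)| ≤ Cerr i * ‖X‖ ^ 2)
    (hsm : ∀ i, Cerr i ≤ (4 / Real.pi ^ 2) ^ (P.d + 2) / (2 * (3 * (K i : ℝ) ^ 2 + 2 * (K i : ℝ) ^ 4)))
    (hγle : ∀ i, γ / (M i) ^ 5 ≤ (4 / Real.pi ^ 2) ^ (P.d + 2) / (2 * (3 * (K i : ℝ) ^ 2 + 2 * (K i : ℝ) ^ 4)))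
    (hH : ∀ i Vk x, ‖H i Vk x‖ ≤ h₁ * ‖x‖) (hHst : ∀ i Vk z, ‖Hst i Vk z‖ ≤ hst * ‖z‖)
    (hdV0 : ∀ i Vk, dV i Vk 0 = 0)
    (hdV : ∀ i Vk (u v : F i), ‖u‖ ≤ ρ i → ‖v‖ ≤ ρ i → ‖dV i Vk u - dV i Vk v‖ ≤ ℓ i * ‖u - v‖)
    (hρ : ∀ i, h₁ * r i ≤ ρ i) (hsmall : ∀ i, (M i) ^ 5 / γ * hst * ℓ i * h₁ ≤ 1 / 2)
    (hA : ∀ i Vk (X δ : GaugeSlice (pts (k i) (Λ i)) (T i) (EuclideanSpace ℝ (Fin 3))),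
      HasDerivAt (fun s : ℝ => (fun177std bg M₁ (Z i) (k i)) (expMul su2Chart (ιA (pts (k i) (Λ i)) (T i) (X + s • δ)) (ext i Vk)))
      (⟪δ, Hst i Vk (J i Vk)⟫ + ⟪δ, Hst i Vk (Δ₁ i Vk (H i Vk X))⟫ + ⟪δ, Hst i Vk (dV i Vk (H i Vk X))⟫) 0)
    (hJ : ∀ i ε Vk, 0 < ε → PlaqSmallOn (plaqsInside (pts (k i) (Z i ∩ (Λ i)ᶜ))) ε Vk → ‖J i Vk‖ ≤ cJ * ε)
    (hc3 : ∀ i Vk (B : GaugeSlice (pts (k i) (Λ i)) (T i) (EuclideanSpace ℝ (Fin 3))), ‖B‖ ≤ r i →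
      (IsCriticalPt su2Chart (bondsOf (pts (k i) (Λ i))) (fun177std bg M₁ (Z i) (k i))
          (expMul su2Chart (ιA (pts (k i) (Λ i)) (T i) B) (ext i Vk)) ↔
        ∀ δB : GaugeSlice (pts (k i) (Λ i)) (T i) (EuclideanSpace ℝ (Fin 3)),
          ⟪δB, Hst i Vk (J i Vk)⟫ + ⟪δB, Hst i Vk (Δ₁ i Vk (H i Vk B))⟫ + ⟪δB, Hst i Vk (dV i Vk (H i Vk B))⟫ = 0))
    (hAn : ∀ i ε Vk, 0 < ε → ε ≤ eA i → PlaqSmallOn (plaqsInside (pts (k i) (Z i ∩ (Λ i)ᶜ))) ε Vk → An i ε Vk)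
    -- thresholds (`N i = √|free bonds|`)
    (hN' : ∀ i, Real.sqrt (freeBonds (pts (k i) (Λ i)) (T i)).card * (π / 2 * δc i) ≤ r i)
    (hδ : ∀ i ε, 0 < ε → ε ≤ eD i →
      ((n i : ℝ) + 2) * ((n i : ℝ) + P.d) * (a₁ i + (bx * (M i) ^ 2 * ε + ε)) < δc i)
    (he1 : ∀ i ε, 0 < ε → ε ≤ eD i → (4 * 1 * (2 * (M i) ^ 5 * hst * cJ / γ) + bx * (M i) ^ 2) * ε < a₁ i) :
    B15.Prop1Printed (lfVarOn su2Chart fun i => InstOn.std bg M₁ (Z i) (Λ i) (k i) (M i) (a₁ i) (An i)) := by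

  refine prop1Printed_lfVarOn_su2_box_G0_of_167 hd3 h0 (fun i => InstOn.std bg M₁ (Z i) (Λ i) (k i) (M i) (a₁ i) (An i)) T
    H Hst hadj Δ₁ dV J lo hi n hn hN hbox hZ hTG0 hN5 K hK1 hKn ext hext hlohi hγ hh₁ hhst hcJ hbx hbxM hℓ hr heA heD hδc
    ha₁ hM n' hn' hlead hsm hγle hH hHst hdV0 hdV hρ hsmall hA hJ hc3 (fun i u V hu => ?_) hAn (fun i => rfl) hN' hδ he1
  exact std_f_gaugeAct bg M₁ (hk i) (h181 i) (Λ i) (M i) (An i) u hu V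

end Literature.MathematicalPhysics.QuantumFieldTheory.Balaban1983to89.B15Prop1StdInstanceSU2Box

end
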